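import Literature.AnabelianGeometry.EtaleTheta.RealifiedDivisorMonoidsOfRlfQWeak
import Literature.AlgebraicGeometry.Frobenioids.MonoidFunctorsOnD
import HarnessLib

/-!
# [EtTh] Def 3.6 (i): the binder `hBinj` ("pull-backs of `B₀^Λ` along morphisms of `D₀` are injective") at the
# CONSTRUCTED data `ofRlfZ` / `ofRlfQ` / `ofRlfZWeak` / `ofRlfQWeak` — REDUCED to ONE statement about the Def 3.3 (iii) data

S. Mochizuki, *The étale theta function …*, Publ. RIMS **45** (2009) [MochizukiEtTh2009], Def 3.3 (iii) PDF p.73 (`B₀(Y) =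
lim Mero(Z^log_∞)^{Gal(Z^log_∞/Y)}`: log-meromorphic functions of CONNECTED tempered coverings, contravariant in `Y`), Def 3.6 (i)
p.76 (`B₀^Λ := B₀` for `Λ = ℤ`, `:= B₀^pf` for `Λ = ℚ`) [cite: MochizukiEtTh2009, Def 3.6 p.76]; S. Mochizuki, *The geometry of
Frobenioids I* (2008), Def 1.1 (ii) p.19 / Thm 5.2 preamble p.100 ("`B` a group-like monoid on `D`": pull-back maps injective).

abc-iut cell, layer L2, seat abc-iut-L2-t3 (gen 4; owner of the Def 3.3 (iii)/3.6 (i)(ii) interfaces).  PROOF-ONLY (0 defs).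
After tonight's sub-DAG work the residual of [EtTh] Thm 4.4 (i)(ii)(iii) at the GENUINE connected base is `{hBinj₁, hBinj₂,
T44-L15b}` (abc-iut-w5-d179 g4, `BiKummerThm44SubModelConnectedBinj.lean` p434227; `hBinj` is also the binder of abc-iut-L2-t3's
`TemperedFrobenioid.isMonoidOn_ratFnFunctor` / `isFrobenioid_of_structural` and of `Discharge/Sec3RatFnMonoidOn`), where
`hBinj : ∀ {Y Y'} (g : Y ⟶ Y'), Injective (T.BΛ.map g).hom` is a property of the Def 3.6 (i) datum `B₀^Λ` of `T`.  For the data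
CONSTRUCTED from Def 3.3 (iii) data `dm` this file reduces it to the ONE `B₀`-level statement
`hB₀inj : ∀ {Y Y'} (g : Y ⟶ Y'), Injective (dm.B₀.map g).hom` — "the function field of a connected covering embeds in that of a
connected covering above it" (for the genuine `B₀` an inclusion of invariants inside `Mero(Z^log_∞)`):
* `ofRlfZ_hBinj`, `ofRlfZWeak_hBinj` — `Λ = ℤ`: `B₀^ℤ = B₀`, verbatim;
* `ofRlfQ_hBinj`, `ofRlfQWeak_hBinj` — `Λ = ℚ`: `B₀^ℚ = B₀^pf` and L1's `perfectionMap_injective` ([FrdI] Def 1.1 (ii): `f`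
  injective ⇒ `f^pf` injective).
NOT here: `Λ = ℝ` (`B₀^ℝ = ℝ·Φ₀^birat ⊆ (Φ₀^rlf)^gp`, `ofRlfR`): injectivity of realified pull-backs is NOT formal (cell finding
P53-F2, `RealificationMapNotInjective` / `…FiniteSupp` / `…AtTheData`: it needs finitely supported divisors, which the special-fibre
divisor of a tempered covering is not) — stays the binder `hBinj` there.  Census consequence (13:00Z v-next, owner's list
`HOME/staging/L2/L2-t3/VNEXT-CENSUS-Sec3-Sec4-L2t3.md`): at `Λ ∈ {ℤ, ℚ}` the input is the Def 3.3 (iii)-level clause `hB₀inj`.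
HONEST FRAMING: refereed pre-IUT material; a reduction between explicit hypotheses, nothing asserted for abstract data; nothing
here bears on [IUTchIII] Cor. 3.12.
-/

namespace Literature.AnabelianGeometry.EtaleTheta

open CategoryTheory Opposite Function Literature.AlgebraicGeometry.Frobenioids

universe u v w

namespace RealifiedDivisorMonoids

variable {D₀ : Type u} [Category.{v} D₀] (dm : DivisorMonoids.{u, v, w} D₀)

section Strong

variable (hpf : ∀ Y : D₀ᵒᵖ, IsPerfFactorial (dm.Φ₀.obj Y))

/-- **`hBinj` at `ofRlfZ dm hpf`** (`B₀^ℤ = B₀`): verbatim the `B₀`-level injectivity. [cite: MochizukiEtTh2009, Def 3.6 p.76] -/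
theorem ofRlfZ_hBinj (hB₀inj : ∀ {Y Y' : D₀ᵒᵖ} (g : Y ⟶ Y'), Injective (dm.B₀.map g).hom) :
    ∀ {Y Y' : D₀ᵒᵖ} (g : Y ⟶ Y'), Injective ((ofRlfZ dm hpf).BΛ.map g).hom :=
  fun g => hB₀inj g

/-- **`hBinj` at `ofRlfQ dm hpf`** (`B₀^ℚ = B₀^pf`): `f` injective ⇒ `f^pf` injective (L1 `perfectionMap_injective`).
[cite: MochizukiEtTh2009, Def 3.6 p.76] -/
theorem ofRlfQ_hBinj (hB₀inj : ∀ {Y Y' : D₀ᵒᵖ} (g : Y ⟶ Y'), Injective (dm.B₀.map g).hom) :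
    ∀ {Y Y' : D₀ᵒᵖ} (g : Y ⟶ Y'), Injective ((ofRlfQ dm hpf).BΛ.map g).hom :=
  fun g => perfectionMap_injective (dm.B₀.map g).hom (hB₀inj g)

end Strong

section Weak

variable (hpf : ∀ Y : D₀ᵒᵖ, IsPerfFactorialCof (dm.Φ₀.obj Y))

/-- **`hBinj` at `ofRlfZWeak dm hpf`** (weak vocabulary, `B₀^ℤ = B₀`). [cite: MochizukiEtTh2009, Def 3.6 p.76] -/
theorem ofRlfZWeak_hBinj (hB₀inj : ∀ {Y Y' : D₀ᵒᵖ} (g : Y ⟶ Y'), Injective (dm.B₀.map g).hom) :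
    ∀ {Y Y' : D₀ᵒᵖ} (g : Y ⟶ Y'), Injective ((ofRlfZWeak dm hpf).BΛ.map g).hom :=
  fun g => hB₀inj g

/-- **`hBinj` at `ofRlfQWeak dm hpf`** (weak vocabulary, `B₀^ℚ = B₀^pf`). [cite: MochizukiEtTh2009, Def 3.6 p.76] -/
theorem ofRlfQWeak_hBinj (hB₀inj : ∀ {Y Y' : D₀ᵒᵖ} (g : Y ⟶ Y'), Injective (dm.B₀.map g).hom) :
    ∀ {Y Y' : D₀ᵒᵖ} (g : Y ⟶ Y'), Injective ((ofRlfQWeak dm hpf).BΛ.map g).hom :=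
  fun g => perfectionMap_injective (dm.B₀.map g).hom (hB₀inj g)

end Weak

end RealifiedDivisorMonoids

end Literature.AnabelianGeometry.EtaleTheta
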